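import Mathlib
import Literature.Topology.PlaneTopology.CrosscutProofs
import Summits.CriticalPhenomena.SAWScalingLimit.Theorems.SAWDefectDecoherenceObservableToSLERGateTransferLoops

/-!
# Gate transfer, topology 2: the crosscut of a Jordan domain cut out by a convex body

Support file for the stub `stub_gateTransfer` (the gate transfer
`GateDecomposition → RenewalAccumulation → CarvedToSLE → HexTight → FullIdentification`) of the
line `bridge-gate-renewal` for the crux
`Summit.CriticalPhenomena.SAWScalingLimit.Theses.SAWDefectDecoherence.ObservableToSLER`
(item `stmt-CriticalPhenomena-14005`).

For a bounded convex body `K` with nonempty interior, a point `g ∈ ∂K ∩ D` of the Jordan domain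
`D`, and two distinct points of `∂K` outside `D`:
* `exists_isCrosscut_of_convex` — the component `cut` of `g` in `∂K ∩ D` is a cross-cut of `D`
  minus its two endpoints `D.boundary s`, `D.boundary t` (`s < t < s + 1`), its closure being the
  cross-cut (a simple arc on `∂K`);
* `exists_two_sides_of_convex` (registered sub-goal `stub_convexCrosscut`) — Newman's cross-cut
  theorem (`Newman1939_crosscut_holds`, tree) for this cut: `D ∖ cut = U₁ ⊔ U₂`, two domains
  with frontiers `closure cut ∪ (arc of ∂D)`, whose closures cover `D̄` and meet inside
  `closure cut ⊆ ∂K`.  (Newman 1939, Ch. V §11; Pommerenke 1992, Prop. 2.12.)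
-/

noncomputable section

open scoped BigOperators Topology NNReal ENNReal Classical BoundedContinuousFunction unitInterval
open Filter Set MeasureTheory Metric

namespace Summit.CriticalPhenomena.SAWScalingLimit.Theorems.ObservableToSLER.BridgeGate

open Literature.Topology.PlaneTopology (IsSimpleArc Newman1939_crosscut_holds)
open Literature.Probability.RandomPlanarGeometry (JordanDomain)

section CrosscutSetup

variable (D : JordanDomain) {K : Set ℂ} {g z₁ z₂ : ℂ}

/-- **The component of a point of `∂K ∩ D` in `∂K ∩ D` is the interior of a cross-cut of the
Jordan domain `D`**, for a bounded convex body `K` with nonempty interior whose frontier has two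
distinct points outside `D`: its closure `L` is a simple arc between two boundary points
`D.boundary s`, `D.boundary t` (`s < t < s + 1`) lying, apart from them, in `D`. -/
theorem exists_isCrosscut_of_convex (hKc : Convex ℝ K) (hKi : (interior K).Nonempty)
    (hKb : Bornology.IsBounded K) (hgK : g ∈ frontier K) (hgD : g ∈ D.carrier)
    (hz₁ : z₁ ∈ frontier K) (hz₁D : z₁ ∉ D.carrier) (hz₂ : z₂ ∈ frontier K) (hz₂D : z₂ ∉ D.carrier)
    (hne : z₁ ≠ z₂) :
    ∃ (L : Set ℂ) (s t : ℝ), s < t ∧ t < s + 1 ∧ D.IsCrosscut L (D.boundary s) (D.boundary t) ∧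
      L ⊆ frontier K ∧
      connectedComponentIn (frontier K ∩ D.carrier) g = L \ {D.boundary s, D.boundary t} ∧
      closure (connectedComponentIn (frontier K ∩ D.carrier) g) = L := by
  obtain ⟨θ, hθc, hθp, hθi, hθr, hθ0⟩ := exists_loop_frontier hKc hKi hKb hgK
  obtain ⟨u₁, rfl⟩ : z₁ ∈ range θ := hθr ▸ hz₁
  obtain ⟨u₂, rfl⟩ : z₂ ∈ range θ := hθr ▸ hz₂
  obtain ⟨α, β, hα, hβ, hαβ, hIoo, hαD, hβD, hcomp⟩ :=
    exists_component_arc hθc hθp hθi D.isOpen (hθ0 ▸ hgD) hz₁D hz₂D hne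
  rw [hθr, hθ0] at hcomp
  set L : Set ℂ := θ '' Icc (-α) β with hL
  -- closure of the cut
  have hclos : closure (connectedComponentIn (frontier K ∩ D.carrier) g) = L := by
    rw [hcomp]
    apply Subset.antisymm
    · exact closure_minimal (image_mono Ioo_subset_Icc_self) (isCompact_Icc.image hθc).isClosed
    · rw [hL, ← closure_Ioo (by linarith : (-α) ≠ β)]
      exact image_closure_subset_closure_image hθc
  -- the endpoints
  have hwin : ∀ u ∈ Icc (-α) β, u ∈ Ico (-α) (-α + 1) := fun u hu => ⟨hu.1, by linarith [hu.2]⟩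
  have hinj : InjOn θ (Icc (-α) β) := fun u hu v hv h =>
    injOn_Ico_of_periodic hθp hθi (-α) (hwin u hu) (hwin v hv) h
  have hends_ne : θ (-α) ≠ θ β := fun h => by
    have := hinj ⟨le_rfl, by linarith⟩ ⟨by linarith, le_rfl⟩ h; linarith
  have hLD' : L ⊆ closure D.carrier := by
    rw [← hclos]
    exact closure_mono ((connectedComponentIn_subset _ _).trans inter_subset_right)
  have hfr : ∀ {e : ℂ}, e ∉ D.carrier → e ∈ L → e ∈ frontier D.carrier := by
    intro e heD heL
    rw [frontier, D.isOpen.interior_eq]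
    exact ⟨hLD' heL, heD⟩
  have hαL : θ (-α) ∈ L := ⟨-α, ⟨le_rfl, by linarith⟩, rfl⟩
  have hβL : θ β ∈ L := ⟨β, ⟨by linarith, le_rfl⟩, rfl⟩
  have hαfr : θ (-α) ∈ frontier D.carrier := hfr hαD hαL
  have hβfr : θ β ∈ frontier D.carrier := hfr hβD hβL
  -- boundary parameters `s < t < s + 1`
  obtain ⟨s, t, hst, hts, hs, ht⟩ : ∃ s t : ℝ, s < t ∧ t < s + 1 ∧ D.boundary s = θ (-α) ∧
      D.boundary t = θ β := by
    rw [← D.range_boundary] at hαfr hβfr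
    obtain ⟨s', hs'⟩ := hαfr
    obtain ⟨t', ht'⟩ := hβfr
    have hs₀ : D.boundary (Int.fract s') = θ (-α) := by rw [D.boundary_fract, hs']
    have ht₀ : D.boundary (Int.fract t') = θ β := by rw [D.boundary_fract, ht']
    have hne₀ : Int.fract s' ≠ Int.fract t' := fun h => hends_ne (by rw [← hs₀, ← ht₀, h])
    rcases lt_or_gt_of_ne hne₀ with h | h
    · exact ⟨_, _, h, by linarith [Int.fract_lt_one t', Int.fract_nonneg s'], hs₀, ht₀⟩
    · refine ⟨Int.fract s', Int.fract t' + 1, by linarith [Int.fract_lt_one s', Int.fract_nonneg t'],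
        by linarith, hs₀, ?_⟩
      rw [D.periodic_boundary, ht₀]
  -- the cut is `L` minus its endpoints
  have hcut : connectedComponentIn (frontier K ∩ D.carrier) g = L \ {θ (-α), θ β} := by
    rw [hcomp]
    apply Subset.antisymm
    · rintro _ ⟨u, hu, rfl⟩
      refine ⟨⟨u, Ioo_subset_Icc_self hu, rfl⟩, ?_⟩
      rintro (h | h)
      · exact hαD (h ▸ hIoo u hu)
      · exact hβD ((mem_singleton_iff.1 h) ▸ hIoo u hu)
    · rintro z ⟨⟨u, hu, rfl⟩, hz⟩
      simp only [mem_insert_iff, mem_singleton_iff, not_or] at hz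
      refine ⟨u, ⟨hu.1.lt_of_ne ?_, hu.2.lt_of_ne ?_⟩, rfl⟩
      · rintro h; exact hz.1 (by rw [← h])
      · rintro h; exact hz.2 (by rw [h])
  refine ⟨L, s, t, hst, hts, ⟨?_, hs ▸ hαfr, ht ▸ hβfr, by rwa [hs, ht], ?_⟩, ?_, ?_, hclos⟩
  · -- simple arc
    refine ⟨fun x => θ ((α + β) * x + (-α)), (hθc.comp (by fun_prop)).continuousOn, ?_, ?_,
      by rw [hs]; simp, by rw [ht]; simp⟩
    · intro x hx y hy hxy
      have hmem : ∀ z ∈ Icc (0:ℝ) 1, (α + β) * z + (-α) ∈ Icc (-α) β := fun z hz =>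
        ⟨by nlinarith [hz.1], by nlinarith [hz.2]⟩
      have := hinj (hmem x hx) (hmem y hy) hxy
      have hab : (α + β) ≠ 0 := by linarith
      exact mul_left_cancel₀ hab (by linarith)
    · rw [show (fun x => θ ((α + β) * x + (-α))) = θ ∘ (fun x => (α + β) * x + (-α)) from rfl,
        Set.image_comp, Set.image_affine_Icc' (by linarith : 0 < α + β)]
      simp only [mul_zero, zero_add, mul_one, hL]
      congr 2; ring
  · -- off the endpoints the arc lies in `D`
    rw [hs, ht, ← hcut]
    exact (connectedComponentIn_subset _ _).trans inter_subset_right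
  · exact (image_subset_range θ (Icc (-α) β)).trans hθr.le
  · rw [hcut, hs, ht]

/-- **The two sides of the cut** (Newman's cross-cut theorem applied to the cut of
`exists_isCrosscut_of_convex`): `D ∖ cut` is the disjoint union of two domains `U₁`, `U₂` with
frontiers `closure cut ∪ (arc of ∂D)`; the closures of the two sides cover `closure D` and meet
only inside `closure cut ⊆ frontier K`. -/
theorem exists_two_sides_of_convex (hKc : Convex ℝ K) (hKi : (interior K).Nonempty)
    (hKb : Bornology.IsBounded K) (hgK : g ∈ frontier K) (hgD : g ∈ D.carrier)
    (hz₁ : z₁ ∈ frontier K) (hz₁D : z₁ ∉ D.carrier) (hz₂ : z₂ ∈ frontier K) (hz₂D : z₂ ∉ D.carrier)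
    (hne : z₁ ≠ z₂) {cut : Set ℂ} (hcut : cut = connectedComponentIn (frontier K ∩ D.carrier) g) :
    ∃ (U₁ U₂ : Set ℂ) (s t : ℝ), IsOpen U₁ ∧ IsOpen U₂ ∧ IsConnected U₁ ∧ IsConnected U₂ ∧
      Disjoint U₁ U₂ ∧ U₁ ∪ U₂ = D.carrier \ cut ∧ s < t ∧ t < s + 1 ∧
      frontier U₁ = closure cut ∪ D.boundary '' Icc s t ∧
      frontier U₂ = closure cut ∪ D.boundary '' Icc t (s + 1) ∧
      D.boundary s ∈ closure cut ∧ D.boundary t ∈ closure cut ∧ closure cut ⊆ frontier K ∧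
      closure D.carrier ⊆ closure U₁ ∪ closure U₂ ∧ closure U₁ ∩ closure U₂ ⊆ closure cut := by
  obtain ⟨L, s, t, hst, hts, hcr, hLK, hcutL, hclos⟩ :=
    exists_isCrosscut_of_convex D hKc hKi hKb hgK hgD hz₁ hz₁D hz₂ hz₂D hne
  rw [← hcut] at hcutL hclos
  obtain ⟨U₁, U₂, hU₁o, hU₂o, hU₁c, hU₂c, hdisj, hunion, hf₁, hf₂⟩ :=
    Newman1939_crosscut_holds D L s t hst hts hcr
  obtain ⟨hLarc, haF, hbF, hab, hLD⟩ := hcr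
  have haL : D.boundary s ∈ L := hLarc.left_mem
  have hbL : D.boundary t ∈ L := hLarc.right_mem
  have haD : D.boundary s ∉ D.carrier := fun h => by
    have := haF; rw [frontier, D.isOpen.interior_eq] at this; exact this.2 h
  have hbD : D.boundary t ∉ D.carrier := fun h => by
    have := hbF; rw [frontier, D.isOpen.interior_eq] at this; exact this.2 h
  have hDL : D.carrier \ L = D.carrier \ cut := by
    rw [hcutL]
    ext z
    simp only [Set.mem_sdiff, mem_insert_iff, mem_singleton_iff, not_and, not_not]
    constructor
    · rintro ⟨hz, hzL⟩; exact ⟨hz, fun h => absurd h hzL⟩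
    · rintro ⟨hz, h⟩
      refine ⟨hz, fun hzL => ?_⟩
      rcases h hzL with rfl | rfl
      · exact haD hz
      · exact hbD hz
  rw [hclos]
  refine ⟨U₁, U₂, s, t, hU₁o, hU₂o, hU₁c, hU₂c, hdisj, hDL ▸ hunion, hst, hts, hf₁, hf₂, haL, hbL,
    hLK, ?_, ?_⟩
  · -- the closures of `U₁`, `U₂` cover `D̄`
    intro z hz
    rw [closure_eq_self_union_frontier] at hz
    rcases hz with hz | hz
    · by_cases hzL : z ∈ L
      · exact Or.inl (by rw [closure_eq_self_union_frontier, hf₁]; exact Or.inr (Or.inl hzL))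
      · have : z ∈ U₁ ∪ U₂ := by rw [hunion]; exact ⟨hz, hzL⟩
        exact this.imp (fun h => subset_closure h) (fun h => subset_closure h)
    · rw [← D.range_boundary] at hz
      obtain ⟨v, rfl⟩ := hz
      obtain ⟨w, hw, hwv⟩ := D.periodic_boundary.exists_mem_Ico one_pos v s
      rw [hwv]
      rcases le_or_gt w t with hwt | hwt
      · left
        rw [closure_eq_self_union_frontier, hf₁]
        exact Or.inr (Or.inr ⟨w, ⟨hw.1, hwt⟩, rfl⟩)
      · right
        rw [closure_eq_self_union_frontier, hf₂]
        exact Or.inr (Or.inr ⟨w, ⟨hwt.le, hw.2.le⟩, rfl⟩)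
  · -- the two closures intersect inside `L`
    intro z ⟨hz₁', hz₂'⟩
    by_contra hzL
    have hzU₁ : z ∉ U₁ := fun hz => Set.disjoint_left.1 (hdisj.closure_right hU₁o) hz hz₂'
    have hzU₂ : z ∉ U₂ := fun hz => Set.disjoint_left.1 (hdisj.symm.closure_right hU₂o) hz hz₁'
    rw [closure_eq_self_union_frontier, hf₁] at hz₁'
    rw [closure_eq_self_union_frontier, hf₂] at hz₂'
    have hz₁'' : z ∈ D.boundary '' Icc s t := by
      rcases hz₁' with h | h | h
      · exact absurd h hzU₁
      · exact absurd h hzL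
      · exact h
    have hz₂'' : z ∈ D.boundary '' Icc t (s + 1) := by
      rcases hz₂' with h | h | h
      · exact absurd h hzU₂
      · exact absurd h hzL
      · exact h
    obtain ⟨w₁, hw₁, hw₁z⟩ := hz₁''
    obtain ⟨w₂, hw₂, hw₂z⟩ := hz₂''
    rcases hw₂.2.lt_or_eq with hlt | heq
    · have hw : w₁ = w₂ := D.injOn_boundary_Ico s ⟨hw₁.1, by linarith [hw₁.2]⟩
        ⟨by linarith [hw₂.1], hlt⟩ (hw₁z.trans hw₂z.symm)
      have hwt : w₁ = t := le_antisymm hw₁.2 (hw ▸ hw₂.1)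
      exact hzL (by rw [← hw₁z, hwt]; exact hbL)
    · exact hzL (by rw [← hw₂z, heq, D.periodic_boundary]; exact haL)

end CrosscutSetup

end Summit.CriticalPhenomena.SAWScalingLimit.Theorems.ObservableToSLER.BridgeGate

namespace Summit.CriticalPhenomena.SAWScalingLimit.Theorems.ObservableToSLER.BridgeGate

open Literature.Probability.RandomPlanarGeometry (JordanDomain)

/-- **Registered sub-goal `stub_convexCrosscut`** (self-contained form of `exists_two_sides_of_convex`). -/
theorem stub_convexCrosscut : ∀ (D : Literature.Probability.RandomPlanarGeometry.JordanDomain) (K : Set ℂ) (g z₁ z₂ : ℂ), Convex ℝ K → (interior K).Nonempty → Bornology.IsBounded K → g ∈ frontier K → g ∈ D.carrier → z₁ ∈ frontier K → z₁ ∉ D.carrier → z₂ ∈ frontier K → z₂ ∉ D.carrier → z₁ ≠ z₂ → ∃ (U₁ U₂ : Set ℂ) (s t : ℝ), IsOpen U₁ ∧ IsOpen U₂ ∧ IsConnected U₁ ∧ IsConnected U₂ ∧ Disjoint U₁ U₂ ∧ U₁ ∪ U₂ = D.carrier \ connectedComponentIn (frontier K ∩ D.carrier) g ∧ s < t ∧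 t < s + 1 ∧ frontier U₁ = closure (connectedComponentIn (frontier K ∩ D.carrier) g) ∪ D.boundary '' Set.Icc s t ∧ frontier U₂ = closure (connectedComponentIn (frontier K ∩ D.carrier) g) ∪ D.boundary '' Set.Icc t (s + 1) ∧ D.boundary s ∈ closure (connectedComponentIn (frontier K ∩ D.carrier) g) ∧ D.boundary t ∈ closure (connectedComponentIn (frontier K ∩ D.carrier) g) ∧ closure (connectedComponentIn (frontier K ∩ D.carrier) g) ⊆ frontier K ∧ closure D.carrier ⊆ closure U₁ ∪ closure U₂ ∧ closure U₁ ∩ closure U₂ ⊆ closure (connectedComponentIn (frontier K ∩ D.carrier) g) :=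
  fun D _ _ _ _ hKc hKi hKb hgK hgD hz₁ hz₁D hz₂ hz₂D hne =>
    exists_two_sides_of_convex D hKc hKi hKb hgK hgD hz₁ hz₁D hz₂ hz₂D hne rfl

end Summit.CriticalPhenomena.SAWScalingLimit.Theorems.ObservableToSLER.BridgeGate

end
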